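import Mathlib
import Literature.AlgebraicGeometry.Motives.CurveThroughTwoPointsHypersurfaceModel

/-!
# LangWeilTransfer, support item `TameResolution` (stmt-ValiantsHypothesis-6378) — preliminaries
# for the assembly of the Kronecker parametrisation

Route `LangWeilTransfer` of `ValiantsHypothesis` (conditional route; honest framing: bookkeeping,
nothing here bears on VP ≠ VNP). Small algebra used when the outputs of
`exists_integer_noether_position_linear` and `exists_parametrisation` are packaged into the shape
of `TameResolution` (architecture note of val-lit-p6 g9, final assembly):

* `eq_C_add_sum_of_totalDegree_le_one` — a polynomial of total degree `≤ 1` is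
  `C c₀ + Σ_j C c_j · X_j`;
* `exists_int_relation_of_rat` — an algebraic equation over `ℚ[T]` gives a non-zero one over
  `ℤ[T]` (`ℚ[T]` is the localisation of `ℤ[T]` at the non-zero integers);
* `aeval_finSuccEquiv_symm` — evaluating `(finSuccEquiv ℤ r)⁻¹ P` at `x` is evaluating
  `P ⊗ ℚ ∈ ℚ[T][U]` at `U = x 0` over `T = x ∘ succ`;
* `irreducible_map_finSuccEquiv_symm` — irreducibility of `P ⊗ ℚ` transported through
  `finSuccEquiv`.
-/

noncomputable section

open MvPolynomial

-- the summit and the problem share the name `ValiantsHypothesis` (D-0017 single-conjunct layout)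
set_option linter.dupNamespace false

namespace Summit.ValiantsHypothesis.ValiantsHypothesis.Theorems.LangWeilTransfer

/-- A polynomial of total degree `≤ 1` is `C (coeff 0) + Σ_j C (coeff e_j) · X_j`. -/
theorem eq_C_add_sum_of_totalDegree_le_one {R : Type*} [CommSemiring R] {n : ℕ}
    (L : MvPolynomial (Fin n) R) (hL : L.totalDegree ≤ 1) :
    L = C (coeff 0 L) + ∑ j, C (coeff (Finsupp.single j 1) L) * X j := by
  classical
  refine MvPolynomial.ext _ _ fun β => ?_
  simp only [coeff_add, coeff_C, coeff_sum, coeff_C_mul, coeff_X, mul_ite, mul_one, mul_zero]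
  by_cases hβ0 : β = 0
  · subst hβ0
    simp only [if_true]
    have : ∀ j : Fin n, ¬ (Finsupp.single j 1 : Fin n →₀ ℕ) = 0 := fun j h => by
      have := Finsupp.single_eq_zero.1 h; exact one_ne_zero this
    simp only [this, if_false, Finset.sum_const_zero, add_zero]
  rw [if_neg (Ne.symm hβ0), zero_add]
  by_cases hβ1 : ∃ j, Finsupp.single j 1 = β
  · obtain ⟨j₀, rfl⟩ := hβ1
    rw [Finset.sum_eq_single j₀]
    · rw [if_pos rfl]
    · intro j _ hj
      rw [if_neg]
      intro h
      exact hj (Finsupp.single_left_injective one_ne_zero h)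
    · intro h; exact absurd (Finset.mem_univ j₀) h
  · push Not at hβ1
    have hsum : ∑ j, (if Finsupp.single j 1 = β then coeff (Finsupp.single j 1) L else 0) = 0 :=
      Finset.sum_eq_zero fun j _ => if_neg (hβ1 j)
    rw [hsum]
    -- `β` has degree `≥ 2`
    refine coeff_eq_zero_of_totalDegree_lt (lt_of_le_of_lt hL ?_)
    obtain ⟨j, hj⟩ : ∃ j, β j ≠ 0 := by
      by_contra h
      push Not at h
      exact hβ0 (Finsupp.ext h)
    by_contra hlt
    push Not at hlt
    -- `Σ β ≤ 1` with `β j ≥ 1` forces `β = single j 1`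
    have hle : ∑ i ∈ β.support, β i ≤ 1 := hlt
    have hj1 : β j = 1 := by
      have h1 : β j ≤ ∑ i ∈ β.support, β i :=
        Finset.single_le_sum (f := fun i => β i) (fun _ _ => Nat.zero_le _) (Finsupp.mem_support_iff.2 hj)
      omega
    apply hβ1 j
    ext i
    by_cases hij : i = j
    · subst hij; rw [Finsupp.single_eq_same, hj1]
    · rw [Finsupp.single_eq_of_ne hij]
      by_contra hne
      have hi : β i ≠ 0 := Ne.symm hne
      have h2 : β j + β i ≤ ∑ i ∈ β.support, β i := by
        rw [← Finset.sum_pair (Ne.symm hij)]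
        exact Finset.sum_le_sum_of_subset_of_nonneg
          (by
            intro k hk
            simp only [Finset.mem_insert, Finset.mem_singleton] at hk
            rcases hk with rfl | rfl
            · exact Finsupp.mem_support_iff.2 hj
            · exact Finsupp.mem_support_iff.2 hi)
          (fun _ _ _ => Nat.zero_le _)
      have : 1 ≤ β i := Nat.one_le_iff_ne_zero.2 hi
      omega

/-- **Clearing denominators.** An equation `p(T̄, x) = 0` with `p ∈ ℚ[T][U]` non-zero gives a
non-zero `P ∈ ℤ[T][U]` with `P(T̄, x) = 0` (`ℚ[T]` is the localisation of `ℤ[T]` at `ℤ ∖ 0`;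
Mathlib `IsLocalization.integerNormalization`). -/
theorem exists_int_relation_of_rat {F : Type*} [CommRing F] {r : ℕ}
    (θℚ : MvPolynomial (Fin r) ℚ →+* F) (x : F) (p : Polynomial (MvPolynomial (Fin r) ℚ))
    (hp0 : p ≠ 0) (hp : (p.map θℚ).eval x = 0) :
    ∃ P : Polynomial (MvPolynomial (Fin r) ℤ), P ≠ 0 ∧
      (P.map (θℚ.comp (MvPolynomial.map (Int.castRingHom ℚ)))).eval x = 0 := by
  letI : Algebra (MvPolynomial (Fin r) ℤ) (MvPolynomial (Fin r) ℚ) := MvPolynomial.algebraMvPolynomial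
  let M : Submonoid (MvPolynomial (Fin r) ℤ) := (nonZeroDivisors ℤ).map (C : ℤ →+* MvPolynomial (Fin r) ℤ)
  haveI : IsLocalization M (MvPolynomial (Fin r) ℚ) := MvPolynomial.isLocalization (nonZeroDivisors ℤ) ℚ
  have halg : (algebraMap (MvPolynomial (Fin r) ℤ) (MvPolynomial (Fin r) ℚ)) =
      MvPolynomial.map (Int.castRingHom ℚ) := by
    refine MvPolynomial.ringHom_ext (fun z => ?_) (fun i => ?_)
    · change MvPolynomial.map (algebraMap ℤ ℚ) (C z) = _
      simp only [eq_intCast, map_intCast]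
    · change MvPolynomial.map (algebraMap ℤ ℚ) (X i) = _
      simp only [map_X]
  have hM : M ≤ nonZeroDivisors (MvPolynomial (Fin r) ℤ) := by
    rintro _ ⟨z, hz, rfl⟩
    exact mem_nonZeroDivisors_of_ne_zero
      ((map_ne_zero_iff _ (C_injective _ _)).2 (nonZeroDivisors.ne_zero hz))
  refine ⟨IsLocalization.integerNormalization M p, ?_, ?_⟩
  · rw [Ne, IsLocalization.integerNormalization_eq_zero_iff hM]; exact hp0
  · rw [Polynomial.eval_map, ← halg]
    refine IsLocalization.integerNormalization_eval₂_eq_zero M θℚ p ?_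
    rw [← Polynomial.eval_map]; exact hp

/-- **Evaluation through `finSuccEquiv`.** For `P ∈ ℤ[T][U]` and a point `x` of a `ℚ`-algebra:
`((finSuccEquiv ℤ r)⁻¹ P)(x) = eval₂ (aeval (x ∘ succ)) (x 0) (P ⊗ ℚ)`. -/
theorem aeval_finSuccEquiv_symm {L : Type*} [CommRing L] [Algebra ℚ L] {r : ℕ}
    (P : Polynomial (MvPolynomial (Fin r) ℤ)) (x : Fin (r + 1) → L) :
    aeval x ((finSuccEquiv ℤ r).symm P) =
      Polynomial.eval₂ (aeval (x ∘ Fin.succ) : MvPolynomial (Fin r) ℚ →ₐ[ℚ] L).toRingHom (x 0)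
        (P.map (MvPolynomial.map (Int.castRingHom ℚ))) := by
  set Pm := (finSuccEquiv ℤ r).symm P with hPm
  have hP : P = finSuccEquiv ℤ r Pm := by rw [hPm, AlgEquiv.apply_symm_apply]
  have h1 : aeval x Pm = aeval x (MvPolynomial.map (algebraMap ℤ ℚ) Pm) :=
    (aeval_map_algebraMap ℚ x Pm).symm
  have hx : x = Fin.cons (x 0) (x ∘ Fin.succ) := by
    ext i; refine Fin.cases ?_ (fun k => ?_) i <;> simp
  rw [h1]
  conv_lhs => rw [hx]
  rw [Literature.AlgebraicGeometry.Motives.TwoPointPencil.aeval_cons_eq_aevalTower,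
    Literature.AlgebraicGeometry.Motives.TwoPointPencil.finSuccEquiv_map, ← hP]
  have : (algebraMap ℤ ℚ) = Int.castRingHom ℚ := rfl
  rw [this]
  rfl

/-- **Irreducibility over `ℚ` through `finSuccEquiv`.** -/
theorem irreducible_map_finSuccEquiv_symm {r : ℕ} (Q : Polynomial (MvPolynomial (Fin r) ℤ))
    (hQ : Irreducible (Q.map (MvPolynomial.map (Int.castRingHom ℚ)))) :
    Irreducible (MvPolynomial.map (Int.castRingHom ℚ) ((finSuccEquiv ℤ r).symm Q)) := by
  have hfe : finSuccEquiv ℚ r (MvPolynomial.map (Int.castRingHom ℚ) ((finSuccEquiv ℤ r).symm Q)) =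
      Q.map (MvPolynomial.map (Int.castRingHom ℚ)) := by
    rw [Literature.AlgebraicGeometry.Motives.TwoPointPencil.finSuccEquiv_map, AlgEquiv.apply_symm_apply]
  have h := (MulEquiv.irreducible_iff (finSuccEquiv ℚ r).symm.toMulEquiv).2 hQ
  have hcoe : (finSuccEquiv ℚ r).symm.toMulEquiv (Q.map (MvPolynomial.map (Int.castRingHom ℚ))) =
      MvPolynomial.map (Int.castRingHom ℚ) ((finSuccEquiv ℤ r).symm Q) := by
    rw [← hfe]; exact (finSuccEquiv ℚ r).symm_apply_apply _
  rwa [hcoe] at h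

end Summit.ValiantsHypothesis.ValiantsHypothesis.Theorems.LangWeilTransfer
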